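import Literature.Uncategorized.DiamondCross
import Literature.Uncategorized.DiamondCrossHolds
import HarnessLib

/-!
# Stub `stub_diamondCross` (line quarter-turn-liouville, item S2a)

The bounded cross theorem for two strips, `Literature.Uncategorized.DiamondCross`: separately
holomorphic-and-bounded data on the cross `(S_b × ℝ) ∪ (ℝ × S_b)`, `S_b = {|Im| < b}`, extend to
ONE function holomorphic on the diamond tube `{|Im z| + |Im w| < b}` with the same bound `M`.
Discharged in the tree by `Literature.Uncategorized.DiamondCross_holds`
(`Literature/Uncategorized/DiamondCrossHolds.lean`), whose proof is
`Literature.Analysis.Complex.exists_holomorphic_extension_diamond_of_separately`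
(`Literature/Analysis/Complex/SeparatelyHolomorphicStrips.lean`).
-/

namespace Summit.CriticalPhenomena.Ising3DConformalLimit.Cruxes.LimitRotationInvariant.QuarterTurnLiouville

open Literature.Uncategorized (DiamondCross)

/-- **Stub S2a of the line `quarter-turn-liouville`**: the bounded cross theorem for two strips
(Bernstein 1912 / Siciak 1969; Jarnicki–Pflug 2011) — a function of two real variables whose
slices in each variable extend holomorphically to the strip `{|Im| < b}` with bound `M` is the
restriction of one function holomorphic on the diamond `{|Im z| + |Im w| < b}` and bounded by `M`
there. This is the tree fact `DiamondCross`, discharged by `DiamondCross_holds`. -/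
theorem stub_diamondCross : DiamondCross :=
  Literature.Uncategorized.DiamondCross_holds

end Summit.CriticalPhenomena.Ising3DConformalLimit.Cruxes.LimitRotationInvariant.QuarterTurnLiouville
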